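import Summits.AtomisticToContinuum.HydrodynamicLimit.Theses.JParityClosure
import Summits.AtomisticToContinuum.HydrodynamicLimit.Theorems.RateFloor.Negative.WithoutEtaPos
import Summits.AtomisticToContinuum.HydrodynamicLimit.Theorems.RateFloor.Negative.RAfterN
import Literature.MathematicalPhysics.KineticTheory.CollisionTubeGeometry
import Literature.Analysis.FluidPDE.HardSphereCollisionRecord
import HarnessLib

/-!
# Line `last-flight-poissonization` for crux `JParityClosure.RateFloor` (stmt-AtomisticToContinuum-13080) — SKELETON

Crux (fixed, route decl `Summit.AtomisticToContinuum.HydrodynamicLimit.Theses.JParityClosure.RateFloor`):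
`∃ g₀ ∀ profiles ∃ σ₀ ∀ σ ∀ Φ ∀ τ ∀ χ ≥ 0 ∀ Ξ ≥ 0 bdd ∀ η δ ∃ r₀ ∀ r ∃ N₀ ∀ N`: with local-Gibbs probability `≥ 1 − δ`,
`K_N[χΞ] ≥ g₀ σ³ ∫₀^τ∫ χ B^Ξ_r − η` (uncut, every `τ`).

Idea (card `Ideas/last-flight-poissonization.md`, triage r1-1/2/3 all PASS): one free flight of a freshly EMITTED particle
Riemann–Lebesgue-disperses its position at scales between the diameter `ε_N = σ(N+1)^{-1/3}` and the flight length, and the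
emission law is smooth in velocity (`ω`-average of the gain term), so the AIMED fraction of the shell influx of FRESH pairs is the
geometric one, uniformly in the impact geometry and in the velocities — from below, one-sidedly (every dropped population is
`≥ 0`).  This reduces the UNIFORMITY IN THE MARK of the crux to an UNMARKED one-body recency statistic plus a 3-body upper bound.

Shape of the skeleton (six registered stubs + the kernel-checked composition `RateFloor_of`; all scales hard-wired to `σ`, see §1):
```
  K[χΞ] − R  ≥ c₂ σ³ (I − I_cut) − η                         (C  stub_complementFloor   — residual debt: dense cells ∪ slow pairs)
  R          ≥ W − KO − η                                     (T  stub_tubeTransport     — exact one-sided tube bookkeeping, pathwise)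
  W          ≥ c_A σ³ I_fresh − η                             (A  stub_freshTubesUniform — THE LEVER: dispersion ⇒ aimed fraction geometric)
  I_fresh    ≥ c₁ I_cut − η            (∀ c₁ ≤ c_F)           (F  stub_freshFraction     — recency: the unmarked kinetic leaf)
  KO         ≤ κ σ³ I + η              (∀ κ > 0)              (KO stub_knockOutSmall    — 3-body upper bound)
  ∫χB^Ξ_r    ≤ C_d I + η                                      (S  stub_subgridDomination — the r-step, shared restatement debt)
  ─────────────────────────────────────────────────────────────────────────────────────────────
  K[χΞ]      ≥ (min(c_A c_F, c_c)/(4 C_d)) σ³ ∫χB^Ξ_r − η       (RateFloor_of: ring arithmetic + a six-fold union bound)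
```
`K` = the crux's collision functional; `R` = its part carried by collisions that REALISE a clean fresh aimed episode (§2);
`W` = aimed fresh clean shell influx; `KO` = knocked-out such episodes; `I`, `I_cut`, `I_fresh` = kinetic-cell ideal pair
functionals (all pairs / density-cut & fast pairs / fresh-`i` fast pairs); `∫χB^Ξ_r` = the crux's `r`-mollified ideal functional.

Disproof.lean honoured: `Negative/WithoutEtaPos` (`0 < η` is in every stub and is consumed by the composition — the slack absorbs
the continuity/edge errors of T, A, F and the dropped populations), `Negative/RAfterN` (the filed order `∃ r₀ ∀ r ∃ N₀ ∀ N` is kept in S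
and in the conclusion; the kinetic cell has radius `σ^{-1/2}(N+1)^{-1/3} = σ^{-3/2} ε_N ≫ 2 ε_N`, so no pair functional here is junk-zero);
§1 conventions (`pv` = pre-collisional pair, incoming hemisphere of `hardSphereKernel (w, v)`; `(j,i)` = `(i,j)` through `(n̂,v,w) ↦ (−n̂,w,v)`)
are the ones used in `Rf`, `Kcrux`, `Θm`; §2 (only an O(1)-weight class suppressed by an O(1) factor can matter): the line is a
from-below statement about exactly that class; §6 (equilibrium mean exact by Kac/Santaló; concentration is the issue): A and F are
in-probability statements whose means are right by construction.  Both landed Negative lemmas are imported below; no stub is an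
instance of either (`0 < η` present everywhere; `r` before `N` everywhere).

planner-cruxplan-stmt-AtomisticToContinuum-13080-last-flight-poissoni-0, 2026-08-16.  Elaborates with `sorry` exactly in the six
`stub_*` theorems; `RateFloor_of` is sorry-free.
-/

noncomputable section

open scoped BigOperators Classical InnerProductSpace RealInnerProductSpace ENNReal
open MeasureTheory Set
open Literature.Analysis.FluidPDE Literature.MathematicalPhysics.KineticTheory

namespace Summit.AtomisticToContinuum.HydrodynamicLimit.Cruxes.RateFloor.LastFlightPoissonization

/-! ## §1 Scales (all hard-wired to the reduced diameter `σ`; `N + 1` particles, `ε_N = σ (N+1)^{-1/3}`)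

* spacing scale `s_N = (N+1)^{-1/3}` (`ε_N = σ s_N`);
* kinetic cell radius `ϱ_N = σ^{-1/2} s_N` (occupancy `≍ a σ^{-3/2} → ∞`, `ϱ_N/ε_N = σ^{-3/2} ≫ 2`);
* tube radius `R_N(w) = s_N · min(‖w‖, 1)` for relative velocity `w = v_i − v_j` (traversal time `≤ s_N`, a vanishing fraction
  `≍ σ²a√θ` of the local mean free time — this makes the knock-out share independent of `‖w‖`); shell `(R_N, 2R_N)`;
* slow cutoff `φ_σ(‖w‖)` (`0` for `‖w‖ ≤ 3σ`, `1` for `‖w‖ ≥ 4σ`): on its support `R_N(w) ≥ 3 ε_N`, the shell is outside the core;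
* density cut `g_σ(σ³ρ)` (`1` below `σ^{3/2}/64`, `0` above `σ^{3/2}/32`), read on the kinetic cell: below the cut the local mean free
  path is `≥ 1.8 ×` the fresh-flight threshold;
* fresh-flight window `[ℓ_lo, ℓ_hi] = [4 ϱ_N, m s_N]` measured as (time since the last collision) × (relative speed of that collision)
  — Galilean-invariant and scale-free in the temperature; `ℓ_lo ≥` cell diameter (dispersion covers the cell), `ε_N/ℓ_lo = σ^{3/2}/4`
  (transverse dispersion error), `m` free (chosen after `η` by F);
* energy cut `h_σ(σ² e_ϱ)` (`1` below `1/32`, `0` above `1/16`) on the kinetic cell's kinetic-energy density and lab-speed caps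
  `ψ_σ(‖v‖)` (`1` below `σ^{-1/4}`, `0` above `2σ^{-1/4}`) on both members of the pair: together with the density cut they bound the
  knock-out share of a MAIN-REGIME episode by `≲ 0.3 σ^{1/4}` uniformly (hot, dense, slow and lab-fast populations all go to the
  COMPLEMENT, whose floor is robust: Enskog `Y ≥ 1`).  The MAIN REGIME of the line = density- and energy-cut cell × fast, capped pair;
  the cell cuts of an episode are read at its SHELL-START time on the trajectory (flight-invariant, so T stays exact). -/

/-- The spacing scale `s_N = (N+1)^{-1/3}` (so `hsDiameter σ N = σ * spacing N`). [folklore] -/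
def spacing (N : ℕ) : ℝ := ((N + 1 : ℕ) : ℝ) ^ (-(1 / 3 : ℝ))

/-- The kinetic cell radius `ϱ_N = σ^{-1/2} (N+1)^{-1/3}`. [folklore] -/
def cellRad (σ : ℝ) (N : ℕ) : ℝ := spacing N / Real.sqrt σ

/-- The kinetic cone mollifier of radius `ϱ_N` (the crux's `bx` at scale `ϱ_N`; unit integral). [folklore] -/
def bk (σ : ℝ) (N : ℕ) (x y : T3) : ℝ :=
  3 / (Real.pi * cellRad σ N ^ 3) * max (1 - Torus.euclidDist x y / cellRad σ N) 0

/-- The tube radius `R_N(w) = s_N · min(‖w‖, 1)` of a pair with relative velocity `w`. [folklore] -/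
def tubeRad (N : ℕ) (w : V3) : ℝ := spacing N * min ‖w‖ 1

/-- The slow cutoff `φ_σ(y) = clamp(y/σ − 3, 0, 1)` in the relative speed `y = ‖w‖`. [folklore] -/
def slowCut (σ y : ℝ) : ℝ := max 0 (min 1 (y / σ - 3))

/-- The density cut `g_σ(y) = clamp(2 − 64 y/σ^{3/2}, 0, 1)` in the reduced cell density `y = σ³ρ`. [folklore] -/
def denseCut (σ y : ℝ) : ℝ := max 0 (min 1 (2 - 64 * y / (σ * Real.sqrt σ)))

/-- The energy cut `h_σ(y) = clamp(2 − 32 y, 0, 1)` in `y = σ² e_ϱ` (kinetic-energy density of the cell). [folklore] -/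
def energyCut (y : ℝ) : ℝ := max 0 (min 1 (2 - 32 * y))

/-- The lab-speed cap `ψ_σ(y) = clamp(2 − σ^{1/4} y, 0, 1)` in `y = ‖v‖`. [folklore] -/
def capCut (σ y : ℝ) : ℝ := max 0 (min 1 (2 - Real.sqrt (Real.sqrt σ) * y))

/-- The fresh-flight threshold `ℓ_lo = 4 ϱ_N`. [folklore] -/
def loFlight (σ : ℝ) (N : ℕ) : ℝ := 4 * cellRad σ N

/-- The kinetic-cell mollified empirical density `ρ_ϱ(x) = (N+1)⁻¹ Σ_i bk(x_i, x)` (macroscopic normalisation: `σ³ρ_ϱ` is the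
local reduced density). [folklore] -/
def rhoK (σ : ℝ) (N : ℕ) (zc : Config (N + 1) (Fin 3) T3) (x : T3) : ℝ :=
  ((N : ℝ) + 1)⁻¹ * ∑ i : Fin (N + 1), bk σ N (zc i).1 x

/-- The kinetic-cell mollified kinetic-energy density `e_ϱ(x) = (N+1)⁻¹ Σ_i bk(x_i, x) ‖v_i‖²/2`. [folklore] -/
def energyK (σ : ℝ) (N : ℕ) (zc : Config (N + 1) (Fin 3) T3) (x : T3) : ℝ :=
  ((N : ℝ) + 1)⁻¹ * ∑ i : Fin (N + 1), bk σ N (zc i).1 x * (‖(zc i).2‖ ^ 2 / 2)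

/-- The MAIN-REGIME cell factor `g_σ(σ³ρ_ϱ(x)) h_σ(σ²e_ϱ(x))` of a configuration at a point. [folklore] -/
def cellCut (σ : ℝ) (N : ℕ) (zc : Config (N + 1) (Fin 3) T3) (x : T3) : ℝ :=
  denseCut σ (σ ^ 3 * rhoK σ N zc x) * energyCut (σ ^ 2 * energyK σ N zc x)

/-- The crux's angular pair weight `Θ^Ψ(v, v') = ∫_{S²} Ψ(ω, v, v') ((v' − v)·ω)₊ dω` (incoming hemisphere of the ordered pair). [folklore] -/
def Θm (Ψ : V3 × V3 × V3 → ℝ) (v v' : V3) : ℝ :=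
  ∫ ω : Metric.sphere (0 : V3) 1, Ψ ((ω : V3), v, v') * hardSphereKernel (v', v) ω ∂sphereMeasure

/-- The mark restricted to MAIN-REGIME pairs: `(φ_σ ψ_σ ψ_σ Ξ)(ω, v, v') = φ_σ(‖v − v'‖) ψ_σ(‖v‖) ψ_σ(‖v'‖) Ξ(ω, v, v')` (fast relative
speed, capped lab speeds). [folklore] -/
def mainMark (σ : ℝ) (Ξ : V3 × V3 × V3 → ℝ) : V3 × V3 × V3 → ℝ :=
  fun p => slowCut σ ‖p.2.1 - p.2.2‖ * capCut σ ‖p.2.1‖ * capCut σ ‖p.2.2‖ * Ξ p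

/-- AIMED at unit diameter: apart, approaching, positive discriminant (= the tree's `strictTube` without the flight-time bound;
free relative motion `s ↦ Q + s w`, `w = v_i − v_j`, `Q = ε⁻¹(x_i − x_j)`). [folklore] -/
def Aimed (w Q : V3) : Prop :=
  1 < ‖Q‖ ∧ ⟪Q, w⟫_ℝ < 0 ∧ ‖w‖ ^ 2 * (‖Q‖ ^ 2 - 1) < ⟪Q, w⟫_ℝ ^ 2

/-- BACKWARD free time from relative position `q` (inside `2R_N`) to the outer shell radius `2 R_N(w)`: the positive root of
`‖q − t w‖ = 2 R_N(w)`. [folklore] -/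
def backTime (N : ℕ) (q w : V3) : ℝ :=
  (⟪q, w⟫_ℝ + Real.sqrt (⟪q, w⟫_ℝ ^ 2 - ‖w‖ ^ 2 * (‖q‖ ^ 2 - (2 * tubeRad N w) ^ 2))) / ‖w‖ ^ 2

/-- FRESH particle `i` at time `s` along the curve `γ`: its last collision before `s` (with some partner `k`, at a time `u ∈ [0, s]`,
none in `(u, s)`) has flight length `(s − u)·‖v_i(u) − v_k(u)‖` in the window `[ℓ_lo, m s_N]` (post- and pre-collisional relative
speeds agree). [folklore] -/
def Fresh (σ : ℝ) (N : ℕ) (m ε : ℝ) (γ : ℝ → Config (N + 1) (Fin 3) T3) (i : Fin (N + 1)) (s : ℝ) : Prop :=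
  ∃ u ∈ Set.Icc (0 : ℝ) s, ∃ k : Fin (N + 1), Collide (Torus.geometry (Fin 3)) ε (γ u) i k ∧
    (∀ u' ∈ Set.Ioo u s, ¬ Participates (Torus.geometry (Fin 3)) ε (γ u') i) ∧
    loFlight σ N ≤ (s - u) * ‖(γ u i).2 - (γ u k).2‖ ∧ (s - u) * ‖(γ u i).2 - (γ u k).2‖ ≤ m * spacing N

/-- CLEAN approach of the ordered pair `(i, j)` seen at time `s` with relative data `(q, w)`: the pair reached the outer shell
radius `2R_N` at a time `s − backTime ≥ 0` and neither member took part in a collision since (open interval: a collision AT `s`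
is the event being classified). [folklore] -/
def Clean (N : ℕ) (ε : ℝ) (γ : ℝ → Config (N + 1) (Fin 3) T3) (s : ℝ) (i j : Fin (N + 1)) (q w : V3) : Prop :=
  0 ≤ s - backTime N q w ∧ ∀ u' ∈ Set.Ioo (s - backTime N q w) s,
    ¬ Participates (Torus.geometry (Fin 3)) ε (γ u') i ∧ ¬ Participates (Torus.geometry (Fin 3)) ε (γ u') j

/-- The EPISODE WEIGHT: the crux's integrand `χ Ξ` (times the main-regime pair cutoffs) evaluated at the PREDICTED contact datum of
the free two-body flight — contact time `s + ε t_h(ε⁻¹q)`, position of `i` there, impact normal `n_h`, current velocities `(v, v')`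
(tree `flightTime`, `impactNormal` at unit scale, `flightTime_scale`) — times the cell factor read at the SHELL-START time
`s − backTime` around the position of `i` then.  Every ingredient is constant along the free segment of the episode, and at a
realised contact (`‖ε⁻¹q‖ = 1`, so `t_h = 0`, `n_h = ε⁻¹q`) the first two factors ARE the crux's datum. [folklore] -/
def episodeWeight (σ : ℝ) (N : ℕ) (ε : ℝ) (χ : ℝ × T3 → ℝ) (Ξ : V3 × V3 × V3 → ℝ)
    (γ : ℝ → Config (N + 1) (Fin 3) T3) (s : ℝ) (x : T3) (q v v' : V3) : ℝ :=
  χ (s + ε * flightTime (v - v') (ε⁻¹ • q),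
      (Torus.geometry (Fin 3)).translate x ((ε * flightTime (v - v') (ε⁻¹ • q)) • v)) *
    mainMark σ Ξ (impactNormal (v - v') (ε⁻¹ • q), v, v') *
    cellCut σ N (γ (s - backTime N q (v - v')))
      ((Torus.geometry (Fin 3)).translate x ((-backTime N q (v - v')) • v))

/-- An ACTIVE EPISODE of the ordered pair `(i, j)` at time `s` for relative data `(q, v, v')`: aimed, inside the outer shell radius,
clean since the outer radius, and `i` fresh at the shell start. [folklore] -/
def Episode (σ : ℝ) (N : ℕ) (m ε : ℝ) (γ : ℝ → Config (N + 1) (Fin 3) T3) (s : ℝ) (i j : Fin (N + 1))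
    (q v v' : V3) : Prop :=
  Aimed (v - v') (ε⁻¹ • q) ∧ ‖q‖ < 2 * tubeRad N (v - v') ∧ Clean N ε γ s i j q (v - v') ∧
    Fresh σ N m ε γ i (s - backTime N q (v - v'))

/-! ## §2 The line's functionals (all normalised like the crux: collision-type sums carry `ε_N/(N+1)`, ideal functionals are
compared after a factor `σ³`) -/

/-- `W` — the AIMED FRESH CLEAN SHELL INFLUX: `ε/(N+1) ∫₀^τ Σ_{i≠j}` over active episodes currently in the shell `(R_N, 2R_N)`
with predicted contact `≤ τ`, of the inward radial speed `/ R_N` (so a complete shell passage contributes exactly `1`) times the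
episode weight. [folklore] -/
def Wf (σ : ℝ) (N : ℕ) (Φ : HardSphereFlow (Torus.geometry (Fin 3)) (hsDiameter σ N) (N + 1)) (τ : ℝ)
    (χ : ℝ × T3 → ℝ) (Ξ : V3 × V3 × V3 → ℝ) (m : ℝ) (z : Config (N + 1) (Fin 3) T3) : ℝ :=
  let ε := hsDiameter σ N
  let G := Torus.geometry (Fin 3)
  let γ : ℝ → Config (N + 1) (Fin 3) T3 := fun s => Φ.flow s z
  ε / (N + 1 : ℝ) * ∫ s in Set.Icc (0 : ℝ) τ, ∑ i : Fin (N + 1), ∑ j : Fin (N + 1),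
    (if i ≠ j ∧ Episode σ N m ε γ s i j (G.sepVec (γ s i).1 (γ s j).1) (γ s i).2 (γ s j).2 ∧
          tubeRad N ((γ s i).2 - (γ s j).2) < ‖G.sepVec (γ s i).1 (γ s j).1‖ ∧
          s + ε * flightTime ((γ s i).2 - (γ s j).2) (ε⁻¹ • G.sepVec (γ s i).1 (γ s j).1) ≤ τ then
        max (-⟪G.sepVec (γ s i).1 (γ s j).1, (γ s i).2 - (γ s j).2⟫_ℝ) 0 /
            (tubeRad N ((γ s i).2 - (γ s j).2) * ‖G.sepVec (γ s i).1 (γ s j).1‖) *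
          episodeWeight σ N ε χ Ξ γ s (γ s i).1 (G.sepVec (γ s i).1 (γ s j).1) (γ s i).2 (γ s j).2
      else 0)

/-- One knock-out term: the episode weight of `(i, j)` at time `u` for the (pre-collisional) velocities `(v, v')`, if that
episode is active. [folklore] -/
def koTerm (σ : ℝ) (N : ℕ) (m ε : ℝ) (χ : ℝ × T3 → ℝ) (Ξ : V3 × V3 × V3 → ℝ)
    (γ : ℝ → Config (N + 1) (Fin 3) T3) (u : ℝ) (i j : Fin (N + 1)) (v v' : V3) : ℝ :=
  if Episode σ N m ε γ u i j ((Torus.geometry (Fin 3)).sepVec (γ u i).1 (γ u j).1) v v' then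
    episodeWeight σ N ε χ Ξ γ u (γ u i).1 ((Torus.geometry (Fin 3)).sepVec (γ u i).1 (γ u j).1) v v'
  else 0

/-- `KO` — the KNOCKED-OUT EPISODES: `ε/(N+1) Σ` over collision times `u ≤ τ` and triples `i, j, k` distinct of the episode weight
of `(i, j)` (with PRE-collisional velocities, recovered by `reflectVel` across the contact separation — the trajectory is
right-continuous, Disproof §1 `pv_eq_precollisional`) whenever `i` or `j` is in contact with the third particle `k` at `u`.
An upper bound for the `W`-weight lost to third-party collisions (partial passages are charged in full). [folklore] -/
def KOf (σ : ℝ) (N : ℕ) (Φ : HardSphereFlow (Torus.geometry (Fin 3)) (hsDiameter σ N) (N + 1)) (τ : ℝ)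
    (χ : ℝ × T3 → ℝ) (Ξ : V3 × V3 × V3 → ℝ) (m : ℝ) (z : Config (N + 1) (Fin 3) T3) : ℝ :=
  let ε := hsDiameter σ N
  let G := Torus.geometry (Fin 3)
  let γ : ℝ → Config (N + 1) (Fin 3) T3 := fun s => Φ.flow s z
  ε / (N + 1 : ℝ) * ∑ᶠ (u : ℝ) (_ : u ∈ collisionTimes G ε γ ∩ Set.Icc 0 τ),
    ∑ i : Fin (N + 1), ∑ j : Fin (N + 1), ∑ k : Fin (N + 1),
      (if i ≠ j ∧ j ≠ k ∧ i ≠ k then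
          (if (i, k) ∈ contactPairs G ε (γ u) then
              koTerm σ N m ε χ Ξ γ u i j
                (reflectVel (G.sepVec (γ u i).1 (γ u k).1) ((γ u i).2, (γ u k).2)).1 (γ u j).2
            else 0) +
          (if (j, k) ∈ contactPairs G ε (γ u) then
              koTerm σ N m ε χ Ξ γ u i j
                (γ u i).2 (reflectVel (G.sepVec (γ u j).1 (γ u k).1) ((γ u j).2, (γ u k).2)).1
            else 0)
        else 0)

/-- `R` — the REALISED part of the crux's collision functional: over ordered contact pairs at collision times `≤ τ`, the episode
weight at contact (there `t_h = 0`, `n_h = ε⁻¹(x_i − x_j)`: it is the crux's term `χ(s, x_i) Ξ(n̂, v⁻, w⁻)` times the main-regime pair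
cutoffs and the shell-start cell factor, hence termwise `≤` the crux's `K`), kept only when the collision closes a CLEAN approach from
the outer shell radius with `i` FRESH at the shell start (pre-collisional velocities by `reflectVel`, Disproof §1). [folklore] -/
def Rf (σ : ℝ) (N : ℕ) (Φ : HardSphereFlow (Torus.geometry (Fin 3)) (hsDiameter σ N) (N + 1)) (τ : ℝ)
    (χ : ℝ × T3 → ℝ) (Ξ : V3 × V3 × V3 → ℝ) (m : ℝ) (z : Config (N + 1) (Fin 3) T3) : ℝ :=
  let ε := hsDiameter σ N
  let G := Torus.geometry (Fin 3)
  let γ : ℝ → Config (N + 1) (Fin 3) T3 := fun s => Φ.flow s z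
  ε / (N + 1 : ℝ) * ∑ᶠ (s : ℝ) (_ : s ∈ collisionTimes G ε γ ∩ Set.Icc 0 τ),
    ∑ i : Fin (N + 1), ∑ j : Fin (N + 1),
      (if i ≠ j ∧ ‖G.sepVec (γ s i).1 (γ s j).1‖ = ε ∧
            Clean N ε γ s i j (G.sepVec (γ s i).1 (γ s j).1)
              ((reflectVel (G.sepVec (γ s i).1 (γ s j).1) ((γ s i).2, (γ s j).2)).1 -
                (reflectVel (G.sepVec (γ s i).1 (γ s j).1) ((γ s i).2, (γ s j).2)).2) ∧
            Fresh σ N m ε γ i (s - backTime N (G.sepVec (γ s i).1 (γ s j).1)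
              ((reflectVel (G.sepVec (γ s i).1 (γ s j).1) ((γ s i).2, (γ s j).2)).1 -
                (reflectVel (G.sepVec (γ s i).1 (γ s j).1) ((γ s i).2, (γ s j).2)).2)) then
          episodeWeight σ N ε χ Ξ γ s (γ s i).1 (G.sepVec (γ s i).1 (γ s j).1)
            (reflectVel (G.sepVec (γ s i).1 (γ s j).1) ((γ s i).2, (γ s j).2)).1
            (reflectVel (G.sepVec (γ s i).1 (γ s j).1) ((γ s i).2, (γ s j).2)).2
        else 0)

/-- `K` — the crux's collision functional `K_N[χΞ]`, verbatim the route decl's `Kc` applied to its mark (kept definitionally equal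
to the zeta-reduced text of `RateFloor`, which `RateFloor_of` exploits by `show`). [folklore] -/
def Kcrux (σ : ℝ) (N : ℕ) (Φ : HardSphereFlow (Torus.geometry (Fin 3)) (hsDiameter σ N) (N + 1)) (τ : ℝ)
    (χ : ℝ × T3 → ℝ) (Ξ : V3 × V3 × V3 → ℝ) (z : Config (N + 1) (Fin 3) T3) : ℝ :=
  let ε := hsDiameter σ N
  let G := Torus.geometry (Fin 3)
  let γ : ℝ → Config (N + 1) (Fin 3) T3 := fun s => Φ.flow s z
  ε / (N + 1 : ℝ) * ∑ᶠ (s : ℝ) (_ : s ∈ collisionTimes G ε γ ∩ Set.Icc 0 τ),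
    ∑ i : Fin (N + 1), ∑ j : Fin (N + 1),
      (if i ≠ j ∧ ‖G.sepVec (γ s i).1 (γ s j).1‖ = ε then
          χ (s, (γ s i).1) *
            Ξ (ε⁻¹ • G.sepVec (γ s i).1 (γ s j).1,
              (reflectVel (G.sepVec (γ s i).1 (γ s j).1) ((γ s i).2, (γ s j).2)).1,
              (reflectVel (G.sepVec (γ s i).1 (γ s j).1) ((γ s i).2, (γ s j).2)).2)
        else 0)

/-- `∫χB^Ξ_r` — the crux's `r`-mollified ideal pair functional `∫₀^τ∫ χ(s,x) B^Ξ_r(z,s,x) dx ds`, verbatim the route decl's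
`bx / Θ / B` (product of the empirical measure with itself), definitionally equal to the zeta-reduced crux text. [folklore] -/
def Irr (σ : ℝ) (N : ℕ) (Φ : HardSphereFlow (Torus.geometry (Fin 3)) (hsDiameter σ N) (N + 1)) (τ : ℝ)
    (χ : ℝ × T3 → ℝ) (Ξ : V3 × V3 × V3 → ℝ) (r : ℝ) (z : Config (N + 1) (Fin 3) T3) : ℝ :=
  let γ : ℝ → Config (N + 1) (Fin 3) T3 := fun s => Φ.flow s z
  let bx : UnitAddTorus (Fin 3) → UnitAddTorus (Fin 3) → ℝ :=
    fun x y => 3 / (Real.pi * r ^ 3) * max (1 - Torus.euclidDist x y / r) 0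
  let Θ := fun (Ξ : EuclideanSpace ℝ (Fin 3) × EuclideanSpace ℝ (Fin 3) × EuclideanSpace ℝ (Fin 3) → ℝ)
      (v w : EuclideanSpace ℝ (Fin 3)) =>
    ∫ ω : Metric.sphere (0 : EuclideanSpace ℝ (Fin 3)) 1, Ξ ((ω : EuclideanSpace ℝ (Fin 3)), v, w) *
      hardSphereKernel (w, v) ω ∂sphereMeasure
  let B := fun Ξ s (x₀ : UnitAddTorus (Fin 3)) =>
    ∫ p, bx p.1.1 x₀ * bx p.2.1 x₀ * Θ Ξ p.1.2 p.2.2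
      ∂((empiricalMeasure (γ s)).prod (empiricalMeasure (γ s)))
  ∫ s in Set.Icc (0 : ℝ) τ, ∫ x : UnitAddTorus (Fin 3), χ (s, x) * B Ξ s x

/-- `I^Ψ` — the KINETIC-CELL ideal pair functional with pair weight `Ψ`: `∫₀^τ∫ χ(s,x) (N+1)^{-2} Σ_{i,j} bk(x_i,x) bk(x_j,x)
Θ^Ψ(v_i,v_j) dx ds` (the crux's `B` at the kinetic radius `ϱ_N`, written as an index sum; the diagonal carries `Θ^Ψ(v,v) = 0`). [folklore] -/
def Ik (σ : ℝ) (N : ℕ) (Φ : HardSphereFlow (Torus.geometry (Fin 3)) (hsDiameter σ N) (N + 1)) (τ : ℝ)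
    (χ : ℝ × T3 → ℝ) (Ψ : V3 × V3 × V3 → ℝ) (z : Config (N + 1) (Fin 3) T3) : ℝ :=
  ∫ s in Set.Icc (0 : ℝ) τ, ∫ x : T3, χ (s, x) *
    (((N : ℝ) + 1)⁻¹ ^ 2 * ∑ i : Fin (N + 1), ∑ j : Fin (N + 1),
      bk σ N (Φ.flow s z i).1 x * bk σ N (Φ.flow s z j).1 x * Θm Ψ (Φ.flow s z i).2 (Φ.flow s z j).2)

/-- `I_cut` — the kinetic ideal functional of the line's MAIN REGIME: density- and energy-cut cells (`cellCut` at the current time,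
at the cell centre), fast capped pairs (`mainMark`). [folklore] -/
def Ikcut (σ : ℝ) (N : ℕ) (Φ : HardSphereFlow (Torus.geometry (Fin 3)) (hsDiameter σ N) (N + 1)) (τ : ℝ)
    (χ : ℝ × T3 → ℝ) (Ξ : V3 × V3 × V3 → ℝ) (z : Config (N + 1) (Fin 3) T3) : ℝ :=
  ∫ s in Set.Icc (0 : ℝ) τ, ∫ x : T3, χ (s, x) * cellCut σ N (Φ.flow s z) x *
    (((N : ℝ) + 1)⁻¹ ^ 2 * ∑ i : Fin (N + 1), ∑ j : Fin (N + 1),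
      bk σ N (Φ.flow s z i).1 x * bk σ N (Φ.flow s z j).1 x *
        Θm (mainMark σ Ξ) (Φ.flow s z i).2 (Φ.flow s z j).2)

/-- `I_fresh` — the main-regime kinetic ideal functional restricted to pairs `(i, j)` with `i` FRESH at the current time. [folklore] -/
def Ikfresh (σ : ℝ) (N : ℕ) (Φ : HardSphereFlow (Torus.geometry (Fin 3)) (hsDiameter σ N) (N + 1)) (τ : ℝ)
    (χ : ℝ × T3 → ℝ) (Ξ : V3 × V3 × V3 → ℝ) (m : ℝ) (z : Config (N + 1) (Fin 3) T3) : ℝ :=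
  ∫ s in Set.Icc (0 : ℝ) τ, ∫ x : T3, χ (s, x) * cellCut σ N (Φ.flow s z) x *
    (((N : ℝ) + 1)⁻¹ ^ 2 * ∑ i : Fin (N + 1), ∑ j : Fin (N + 1),
      (if Fresh σ N m (hsDiameter σ N) (fun u => Φ.flow u z) i s then
          bk σ N (Φ.flow s z i).1 x * bk σ N (Φ.flow s z j).1 x *
            Θm (mainMark σ Ξ) (Φ.flow s z i).2 (Φ.flow s z j).2
        else 0))

/-! ## §3 The six registered stubs

Common prefix (the crux's): profiles `a₀, θ₀, u₀` continuous and positive; `∃ σ₀(profiles)`; `σ ∈ (0, σ₀)`; any flow family `Φ`;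
`τ > 0`; `χ ≥ 0` continuous; `Ξ ≥ 0` continuous bounded; `η, δ > 0`; then the stub's own late parameters (`m`, resp. `r`) and
`∃ N₀ ∀ N ≥ N₀`.  Constants of the floors are EXISTENTIAL and come FIRST (universal in the profiles), except `κ` of KO (any `κ > 0`,
with `σ₀` allowed to depend on it) — this is what lets `RateFloor_of` produce the crux's leading `∃ g₀`. -/

/-- **T · ONE-SIDED TUBE TRANSPORT** (`stub_tubeTransport`).  Pathwise on the flow's good set (so the event below is Liouville-null,
hence local-Gibbs-null): every active episode counted by `W` ends, no later than `τ`, either in the collision of its own pair — then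
`R` counts exactly the episode weight (every factor of `episodeWeight` is constant along the free two-body flight: `flightTime_sub_smul`,
`impactNormal_sub_smul`, `Alexander.sepVec_freeFlight_eq` in the chart `‖q‖ ≤ 2 s_N ≪ 1/2`, and the cell factor is read at the fixed
shell-start time; `Clean` at contact says precisely that the pair flew freely from the outer radius `2R_N`, where `backTime` puts the
shell start) — or in a third-party collision of `i` or `j`, counted by `KO` with the full weight `≥` the accumulated one; a complete shell
passage accumulates exactly `∫_{R}^{2R} da/R = 1` (inward radial speed `−⟨q,w⟩/‖q‖`); an episode that begins INSIDE the shell (time `0`,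
or a kick) accumulates less in `W` and is charged in full by `R`/`KO`, and one whose fictitious shell start precedes `0` or the kick is
excluded from all three by `Clean` — both in the safe direction.  Hence `R ≥ W − KO` surely; `η > 0` is carried only to stay in the crux's
currency.  Why it might fail: only by a convention slip (right-continuity of velocities at collision times — Disproof §1; `Ioo`/`Icc` ends;
simultaneous collisions and grazing contacts are off the good set).  Size L; the dead line's kinematic layer is landed and reusable
(`RateFloorPerParticleFreeStretch` S1, `…WouldBeRealised` S2, `…PathwiseTransfer`, `…RealisedDatum`, the tube bridge
`JParityClosureRateFloorTubeBridge`, `IsHardSphereTrajectory.sub_eq_integral_add_finsum_collisionJump_td`).  Provable now. [size L] -/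
def Stubs.stub_tubeTransport : Prop :=
  ∀ (a₀ θ₀ : T3 → ℝ) (u₀ : T3 → V3), Continuous a₀ → Continuous θ₀ → Continuous u₀ → (∀ x, 0 < a₀ x) →
    (∀ x, 0 < θ₀ x) → ∃ σ₀ : ℝ, 0 < σ₀ ∧ ∀ σ : ℝ, 0 < σ → σ < σ₀ →
    ∀ Φ : (N : ℕ) → HardSphereFlow (Torus.geometry (Fin 3)) (hsDiameter σ N) (N + 1),
    ∀ τ : ℝ, 0 < τ → ∀ χ : ℝ × T3 → ℝ, Continuous χ → (∀ p, 0 ≤ χ p) →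
    ∀ Ξ : V3 × V3 × V3 → ℝ, Continuous Ξ → (∀ q, 0 ≤ Ξ q) → (∃ C : ℝ, ∀ q, Ξ q ≤ C) →
    ∀ η δ : ℝ, 0 < η → 0 < δ → ∀ m : ℝ, 1 ≤ m → ∃ N₀ : ℕ, ∀ N : ℕ, N₀ ≤ N →
      localGibbsLaw σ a₀ u₀ θ₀ N (Φ N)
        {z | Rf σ N (Φ N) τ χ Ξ m z < Wf σ N (Φ N) τ χ Ξ m z - KOf σ N (Φ N) τ χ Ξ m z - η} ≤ ENNReal.ofReal δ

/-- Registered stub T (`Stubs.stub_tubeTransport`, verbatim). -/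
theorem stub_tubeTransport :
  ∀ (a₀ θ₀ : T3 → ℝ) (u₀ : T3 → V3), Continuous a₀ → Continuous θ₀ → Continuous u₀ → (∀ x, 0 < a₀ x) →
    (∀ x, 0 < θ₀ x) → ∃ σ₀ : ℝ, 0 < σ₀ ∧ ∀ σ : ℝ, 0 < σ → σ < σ₀ →
    ∀ Φ : (N : ℕ) → HardSphereFlow (Torus.geometry (Fin 3)) (hsDiameter σ N) (N + 1),
    ∀ τ : ℝ, 0 < τ → ∀ χ : ℝ × T3 → ℝ, Continuous χ → (∀ p, 0 ≤ χ p) →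
    ∀ Ξ : V3 × V3 × V3 → ℝ, Continuous Ξ → (∀ q, 0 ≤ Ξ q) → (∃ C : ℝ, ∀ q, Ξ q ≤ C) →
    ∀ η δ : ℝ, 0 < η → 0 < δ → ∀ m : ℝ, 1 ≤ m → ∃ N₀ : ℕ, ∀ N : ℕ, N₀ ≤ N →
      localGibbsLaw σ a₀ u₀ θ₀ N (Φ N)
        {z | Rf σ N (Φ N) τ χ Ξ m z < Wf σ N (Φ N) τ χ Ξ m z - KOf σ N (Φ N) τ χ Ξ m z - η} ≤ ENNReal.ofReal δ := by
  sorry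

/-- **A · FRESH TUBES ARE UNIFORMLY FILLED — the lever** (`stub_freshTubesUniform`).  There is a universal `c_A > 0` (truth: any
`c_A < 1`) such that along the local-Gibbs hard-sphere flow, for `σ < σ₀(profiles)`, the aimed fresh clean shell influx dominates
`c_A σ³ I_fresh − η` in probability.  Mechanism (card (D)+(E)+(C1), sharpened by triage): (i) one-sided two-body Duhamel over the
last flight of `i` (drop the gain now and the stale remnant, keep the emission of `i` at its last collision); (ii) DISPERSION
(`dispersion_decay`, one integration by parts: `|∫ f(v) e^{−2πi t⟨k,v⟩} dv| ≤ ‖∇f‖₁/(2π t ‖k‖)`): a flight of length `≥ ℓ_lo = 4ϱ_N`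
converts the smoothness of the emitted-velocity law (an `ω`-average over the impact sphere of the emitting collision — a 2-parameter
family whose radius is the relative speed of THAT collision, hence the Galilean, scale-free freshness window) into flatness of the
position of `i` transverse to `w` at resolution `ε_N` (relative error `≍ ε_N/ℓ_lo = σ^{3/2}/4`) and radially across the kinetic cell
(`ℓ_lo ≥` cell diameter), so the flux of `j`-particles into the aimed disc of a fresh `i` is `ε_N² Θ^{φΞ}(v_i, v_j)` per unit `j`-density —
exactly the normalisation of `σ³ I_fresh` (`(N+1) ε_N³ = σ³`); (iii) the forward bootstrap closes because coarse modulations of the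
impact-parameter law are damped by the factor `ε_N/ℓ_lo` after one flight and fine ones are averaged over the disc; (iv) clean passages
have probability `1 − O(σ^{1/2})` wherever fresh particles exist; (v) concentration (second moment of a sum over `≍ (N+1)^{4/3}σ²τ`
episodes).  Why it might fail: the emission law of a DEGENERATE local velocity distribution (two cold beams) is singular (uniform on a
sphere; Lions/Wennberg/Bouchut–Desvillettes smoothing gains only `(d−1)/2` derivatives over the input), so the dispersion constant hides
a non-degeneracy input on the local velocity law along the flow; sub-cell anti-correlation between emission sites and the `j`-field is
excluded only because `ℓ_lo` exceeds the cell.  Honours `Negative/RAfterN` (`ϱ_N/ε_N = σ^{-3/2}`), uses `0 < η` (edge and continuity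
errors).  Size XL; foreseen `--supports` lemmas: `dispersion_decay` (M, Mathlib Fourier), emission regularity of the level-(2,3) gain
for input pairs of relative speed `≥ a√θ` (L; cf. the landed `RateFloorGainSpreading.stub_gainSpreading`, a Pulvirenti–Wennberg floor
for the gain with Maxwellian partner), the one-sided marginal Duhamel inequality (L, `LiouvilleBBGKY` vocabulary). [size XL] -/
def Stubs.stub_freshTubesUniform : Prop :=
  ∃ cA : ℝ, 0 < cA ∧
  ∀ (a₀ θ₀ : T3 → ℝ) (u₀ : T3 → V3), Continuous a₀ → Continuous θ₀ → Continuous u₀ → (∀ x, 0 < a₀ x) →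
    (∀ x, 0 < θ₀ x) → ∃ σ₀ : ℝ, 0 < σ₀ ∧ ∀ σ : ℝ, 0 < σ → σ < σ₀ →
    ∀ Φ : (N : ℕ) → HardSphereFlow (Torus.geometry (Fin 3)) (hsDiameter σ N) (N + 1),
    ∀ τ : ℝ, 0 < τ → ∀ χ : ℝ × T3 → ℝ, Continuous χ → (∀ p, 0 ≤ χ p) →
    ∀ Ξ : V3 × V3 × V3 → ℝ, Continuous Ξ → (∀ q, 0 ≤ Ξ q) → (∃ C : ℝ, ∀ q, Ξ q ≤ C) →
    ∀ η δ : ℝ, 0 < η → 0 < δ → ∀ m : ℝ, 1 ≤ m → ∃ N₀ : ℕ, ∀ N : ℕ, N₀ ≤ N →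
      localGibbsLaw σ a₀ u₀ θ₀ N (Φ N)
        {z | Wf σ N (Φ N) τ χ Ξ m z < cA * σ ^ 3 * Ikfresh σ N (Φ N) τ χ Ξ m z - η} ≤ ENNReal.ofReal δ

/-- Registered stub A (`Stubs.stub_freshTubesUniform`, verbatim). -/
theorem stub_freshTubesUniform :
  ∃ cA : ℝ, 0 < cA ∧
  ∀ (a₀ θ₀ : T3 → ℝ) (u₀ : T3 → V3), Continuous a₀ → Continuous θ₀ → Continuous u₀ → (∀ x, 0 < a₀ x) →
    (∀ x, 0 < θ₀ x) → ∃ σ₀ : ℝ, 0 < σ₀ ∧ ∀ σ : ℝ, 0 < σ → σ < σ₀ →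
    ∀ Φ : (N : ℕ) → HardSphereFlow (Torus.geometry (Fin 3)) (hsDiameter σ N) (N + 1),
    ∀ τ : ℝ, 0 < τ → ∀ χ : ℝ × T3 → ℝ, Continuous χ → (∀ p, 0 ≤ χ p) →
    ∀ Ξ : V3 × V3 × V3 → ℝ, Continuous Ξ → (∀ q, 0 ≤ Ξ q) → (∃ C : ℝ, ∀ q, Ξ q ≤ C) →
    ∀ η δ : ℝ, 0 < η → 0 < δ → ∀ m : ℝ, 1 ≤ m → ∃ N₀ : ℕ, ∀ N : ℕ, N₀ ≤ N →
      localGibbsLaw σ a₀ u₀ θ₀ N (Φ N)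
        {z | Wf σ N (Φ N) τ χ Ξ m z < cA * σ ^ 3 * Ikfresh σ N (Φ N) τ χ Ξ m z - η} ≤ ENNReal.ofReal δ := by
  sorry

/-- **F · FRESH FRACTION — the kinetic leaf** (`stub_freshFraction`; card C3 "recency", filed as the triage asked).  There is a
universal `c_F > 0` (truth `≈ e^{−1/1.8} ≈ 0.57` at the density cut, `→ 1` in dilute cells) such that for every `c₁ ≤ c_F`, along the
flow, the fresh-`i` fast kinetic functional dominates `c₁ ×` the density-cut fast one, `I_fresh ≥ c₁ I_cut − η`, once the upper window
`m ≥ m₀(…, η)` is long enough (cells so dilute that their mean free path exceeds `m s_N/3` carry ideal weight `≲ σ³ a_*(m)² → 0`).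
Content: in every cell below the cut (local mean free path `≥ 1.8 ℓ_lo`) and for every velocity class, a fixed fraction of the particles
collided within the last `[ℓ_lo, m s_N]` of relative flight — a ONE-BODY, UNMARKED collision-rate floor in probability at macroscopic
times (ages short ⇔ enough collisions).  This is where the ergodic content of the crux is ISOLATED, not removed (triage r1-1 (iii),
r1-3): its natural engine is line L's cut kinetic-scale equilibrium lower tail `E1_cut[Ξ ≡ 1]` + the landed KL transfer
(`RateFloorEntropyTransfer`), or it is crux-grade.  Why it might fail: a sustained deficit of collisions PER PARTICLE (not per pair class)
in dilute cells along a non-equilibrium flow — the unmarked kinetic floor itself; by `Negative/…` nothing; the `∀ c₁ ≤ c_F` form only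
encodes monotonicity in the constant (needs `I_cut ≥ 0`, true: nonnegative integrand).  Uses `0 < η`, `m` after `η`. [size XL / open] -/
def Stubs.stub_freshFraction : Prop :=
  ∃ cF : ℝ, 0 < cF ∧ ∀ c₁ : ℝ, 0 < c₁ → c₁ ≤ cF →
  ∀ (a₀ θ₀ : T3 → ℝ) (u₀ : T3 → V3), Continuous a₀ → Continuous θ₀ → Continuous u₀ → (∀ x, 0 < a₀ x) →
    (∀ x, 0 < θ₀ x) → ∃ σ₀ : ℝ, 0 < σ₀ ∧ ∀ σ : ℝ, 0 < σ → σ < σ₀ →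
    ∀ Φ : (N : ℕ) → HardSphereFlow (Torus.geometry (Fin 3)) (hsDiameter σ N) (N + 1),
    ∀ τ : ℝ, 0 < τ → ∀ χ : ℝ × T3 → ℝ, Continuous χ → (∀ p, 0 ≤ χ p) →
    ∀ Ξ : V3 × V3 × V3 → ℝ, Continuous Ξ → (∀ q, 0 ≤ Ξ q) → (∃ C : ℝ, ∀ q, Ξ q ≤ C) →
    ∀ η δ : ℝ, 0 < η → 0 < δ → ∃ m₀ : ℝ, 1 ≤ m₀ ∧ ∀ m : ℝ, m₀ ≤ m → ∃ N₀ : ℕ, ∀ N : ℕ, N₀ ≤ N →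
      localGibbsLaw σ a₀ u₀ θ₀ N (Φ N)
        {z | Ikfresh σ N (Φ N) τ χ Ξ m z < c₁ * Ikcut σ N (Φ N) τ χ Ξ z - η} ≤ ENNReal.ofReal δ

/-- Registered stub F (`Stubs.stub_freshFraction`, verbatim). -/
theorem stub_freshFraction :
  ∃ cF : ℝ, 0 < cF ∧ ∀ c₁ : ℝ, 0 < c₁ → c₁ ≤ cF →
  ∀ (a₀ θ₀ : T3 → ℝ) (u₀ : T3 → V3), Continuous a₀ → Continuous θ₀ → Continuous u₀ → (∀ x, 0 < a₀ x) →
    (∀ x, 0 < θ₀ x) → ∃ σ₀ : ℝ, 0 < σ₀ ∧ ∀ σ : ℝ, 0 < σ → σ < σ₀ →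
    ∀ Φ : (N : ℕ) → HardSphereFlow (Torus.geometry (Fin 3)) (hsDiameter σ N) (N + 1),
    ∀ τ : ℝ, 0 < τ → ∀ χ : ℝ × T3 → ℝ, Continuous χ → (∀ p, 0 ≤ χ p) →
    ∀ Ξ : V3 × V3 × V3 → ℝ, Continuous Ξ → (∀ q, 0 ≤ Ξ q) → (∃ C : ℝ, ∀ q, Ξ q ≤ C) →
    ∀ η δ : ℝ, 0 < η → 0 < δ → ∃ m₀ : ℝ, 1 ≤ m₀ ∧ ∀ m : ℝ, m₀ ≤ m → ∃ N₀ : ℕ, ∀ N : ℕ, N₀ ≤ N →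
      localGibbsLaw σ a₀ u₀ θ₀ N (Φ N)
        {z | Ikfresh σ N (Φ N) τ χ Ξ m z < c₁ * Ikcut σ N (Φ N) τ χ Ξ z - η} ≤ ENNReal.ofReal δ := by
  sorry

/-- **KO · KNOCK-OUTS ARE A SMALL FRACTION** (`stub_knockOutSmall`; card S_ko).  For every `κ > 0`: for `σ < σ₀(κ, profiles)` the
knocked-out episode functional is at most `κ σ³ I + η` in probability (`I` = the UNCUT kinetic ideal functional of the mark `Ξ`).
Heuristic: an episode lasts at most one tube traversal, of duration `R_N(w)/‖w‖ ≤ s_N min(1, 1/‖w‖)`, during which `i` or `j` is hit with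
probability `≤ σ² (a(‖v_i‖ + ‖v_j‖) + 2 a c̄) · min(1, 1/‖w‖)` (`a`, `c̄` the cell's density and mean speed); on MAIN-REGIME episodes
(density `σ³a ≤ σ^{3/2}/32`, energy `σ²e ≤ 1/16` so `a c̄ ≤ √(1.7 a e)`, lab speeds `≤ 2σ^{-1/4}`) this share is `≲ 0.3 σ^{1/4}`
UNIFORMLY — the reason for the energy cut and the speed caps; the `‖w‖`-scaling of `R_N` removes the slow-pair divergence.  A 3-body UPPER
bound (clean passage × third-party hit), not a floor.  Why it might fail: it needs an upper bound on aimed fresh entrances (no clustering of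
`j` in the forward tubes of fresh `i` — the two-sided version of A) and on triple encounters along a non-equilibrium flow, in probability
at macroscopic times.  Engine: Chebyshev on a 3-body tube functional whose mean and variance are static computations at rung 0
(`CollisionTubeVariance*`, `JParityClosureRateFloorTubeChebyshev*` landed at equilibrium); off rung 0 a transfer of an UPPER tail
(entropy inequality `RateFloorEntropyTransfer`-style: upper tails of 3-body counts cost entropy `≍` count, plausibly super-extensive for an
`O(1)` excess).  Uses `0 < η`. [size L–XL] -/
def Stubs.stub_knockOutSmall : Prop :=
  ∀ κ : ℝ, 0 < κ →
  ∀ (a₀ θ₀ : T3 → ℝ) (u₀ : T3 → V3), Continuous a₀ → Continuous θ₀ → Continuous u₀ → (∀ x, 0 < a₀ x) →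
    (∀ x, 0 < θ₀ x) → ∃ σ₀ : ℝ, 0 < σ₀ ∧ ∀ σ : ℝ, 0 < σ → σ < σ₀ →
    ∀ Φ : (N : ℕ) → HardSphereFlow (Torus.geometry (Fin 3)) (hsDiameter σ N) (N + 1),
    ∀ τ : ℝ, 0 < τ → ∀ χ : ℝ × T3 → ℝ, Continuous χ → (∀ p, 0 ≤ χ p) →
    ∀ Ξ : V3 × V3 × V3 → ℝ, Continuous Ξ → (∀ q, 0 ≤ Ξ q) → (∃ C : ℝ, ∀ q, Ξ q ≤ C) →
    ∀ η δ : ℝ, 0 < η → 0 < δ → ∀ m : ℝ, 1 ≤ m → ∃ N₀ : ℕ, ∀ N : ℕ, N₀ ≤ N →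
      localGibbsLaw σ a₀ u₀ θ₀ N (Φ N)
        {z | κ * σ ^ 3 * Ik σ N (Φ N) τ χ Ξ z + η < KOf σ N (Φ N) τ χ Ξ m z} ≤ ENNReal.ofReal δ

/-- Registered stub KO (`Stubs.stub_knockOutSmall`, verbatim). -/
theorem stub_knockOutSmall :
  ∀ κ : ℝ, 0 < κ →
  ∀ (a₀ θ₀ : T3 → ℝ) (u₀ : T3 → V3), Continuous a₀ → Continuous θ₀ → Continuous u₀ → (∀ x, 0 < a₀ x) →
    (∀ x, 0 < θ₀ x) → ∃ σ₀ : ℝ, 0 < σ₀ ∧ ∀ σ : ℝ, 0 < σ → σ < σ₀ →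
    ∀ Φ : (N : ℕ) → HardSphereFlow (Torus.geometry (Fin 3)) (hsDiameter σ N) (N + 1),
    ∀ τ : ℝ, 0 < τ → ∀ χ : ℝ × T3 → ℝ, Continuous χ → (∀ p, 0 ≤ χ p) →
    ∀ Ξ : V3 × V3 × V3 → ℝ, Continuous Ξ → (∀ q, 0 ≤ Ξ q) → (∃ C : ℝ, ∀ q, Ξ q ≤ C) →
    ∀ η δ : ℝ, 0 < η → 0 < δ → ∀ m : ℝ, 1 ≤ m → ∃ N₀ : ℕ, ∀ N : ℕ, N₀ ≤ N →
      localGibbsLaw σ a₀ u₀ θ₀ N (Φ N)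
        {z | κ * σ ^ 3 * Ik σ N (Φ N) τ χ Ξ z + η < KOf σ N (Φ N) τ χ Ξ m z} ≤ ENNReal.ofReal δ := by
  sorry

/-- **C · THE COMPLEMENT FLOOR — residual debt** (`stub_complementFloor`; = the triage's DenseComplement(∀η) ∪ S_slow, in one
statement and in the form the composition consumes).  There is a universal `c_c > 0` (truth: Enskog gives `Y ≥ 1` everywhere, and at
the cut's ramp at least `≈ 43 %` of the fast collisions are NOT clean-and-fresh, so `c_c ≈ 0.4` works) such that for every `c₂ ≤ c_c`:
the collisions NOT credited to the line's mechanism, `K[χΞ] − R`, dominate `c₂ σ³ (I − I_cut) − η` — the ideal weight of the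
COMPLEMENT of the main regime: DENSE cells (`σ³ρ_ϱ ≥ σ^{3/2}/64`, only reachable by compression `≳ 0.015 σ^{-3/2}/a₀`, e.g. Kidder-type
isentropic implosions — the crux is filed for every `τ`), HOT cells (`σ² e_ϱ ≥ 1/32`: implosion foci), SLOW pairs (`‖v−w‖ ≤ 4σ`, ideal
weight `≍ σ⁴`, `N`-independent, not `η`-absorbable for marks supported there; knock-in, not dispersion, feeds their collisions) and LAB-FAST
particles (`‖v‖ ≥ σ^{-1/4}`: Maxwellian tails, supersonic streams).  TRUE on all evidence (Enskog `Y ≥ 1` for every class; EDMD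
j008235/j008239/j009144/j013767: slow pairs, hot–cold streams and compressed slabs collide at `≥ 0.97 Y ×` ideal), but NO mechanism of this
line reaches it: in a near-jammed core there are no fresh particles and no clean passages; slow aimed pairs are knocked out before contact;
in hot cells clean passages fail.  Why it might fail: cone-avoiding marks in an ORIENTED dense
transient (triage W1/N1) — improbable along local-Gibbs flows but beyond entropy transfer at fixed `σ` (cost merely extensive); the
`∀ c₂ ≤ c_c` form needs `I − I_cut ≥ 0` (true: all cutoffs take values in `[0, 1]`).  Difficulty: open-problem (dense/hot part =
DensityCap-type control under `∀ τ`; slow/lab-fast part = the crux on `O(σ⁴)`/Maxwellian-tail weight classes).  The planner's conforming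
restatements (cut `g(σ³ρ)` as in 13078/13079 plus `τ < T` under DensityCap, or a velocity-weighted floor `g₀(|g|, n̂)` — Disproof §4/§6:
the glue needs only an a.e.-positive floor) delete exactly this stub. [size open] -/
def Stubs.stub_complementFloor : Prop :=
  ∃ cc : ℝ, 0 < cc ∧ ∀ c₂ : ℝ, 0 < c₂ → c₂ ≤ cc →
  ∀ (a₀ θ₀ : T3 → ℝ) (u₀ : T3 → V3), Continuous a₀ → Continuous θ₀ → Continuous u₀ → (∀ x, 0 < a₀ x) →
    (∀ x, 0 < θ₀ x) → ∃ σ₀ : ℝ, 0 < σ₀ ∧ ∀ σ : ℝ, 0 < σ → σ < σ₀ →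
    ∀ Φ : (N : ℕ) → HardSphereFlow (Torus.geometry (Fin 3)) (hsDiameter σ N) (N + 1),
    ∀ τ : ℝ, 0 < τ → ∀ χ : ℝ × T3 → ℝ, Continuous χ → (∀ p, 0 ≤ χ p) →
    ∀ Ξ : V3 × V3 × V3 → ℝ, Continuous Ξ → (∀ q, 0 ≤ Ξ q) → (∃ C : ℝ, ∀ q, Ξ q ≤ C) →
    ∀ η δ : ℝ, 0 < η → 0 < δ → ∀ m : ℝ, 1 ≤ m → ∃ N₀ : ℕ, ∀ N : ℕ, N₀ ≤ N →
      localGibbsLaw σ a₀ u₀ θ₀ N (Φ N)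
        {z | Kcrux σ N (Φ N) τ χ Ξ z - Rf σ N (Φ N) τ χ Ξ m z <
              c₂ * σ ^ 3 * (Ik σ N (Φ N) τ χ Ξ z - Ikcut σ N (Φ N) τ χ Ξ z) - η} ≤ ENNReal.ofReal δ

/-- Registered stub C (`Stubs.stub_complementFloor`, verbatim). -/
theorem stub_complementFloor :
  ∃ cc : ℝ, 0 < cc ∧ ∀ c₂ : ℝ, 0 < c₂ → c₂ ≤ cc →
  ∀ (a₀ θ₀ : T3 → ℝ) (u₀ : T3 → V3), Continuous a₀ → Continuous θ₀ → Continuous u₀ → (∀ x, 0 < a₀ x) →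
    (∀ x, 0 < θ₀ x) → ∃ σ₀ : ℝ, 0 < σ₀ ∧ ∀ σ : ℝ, 0 < σ → σ < σ₀ →
    ∀ Φ : (N : ℕ) → HardSphereFlow (Torus.geometry (Fin 3)) (hsDiameter σ N) (N + 1),
    ∀ τ : ℝ, 0 < τ → ∀ χ : ℝ × T3 → ℝ, Continuous χ → (∀ p, 0 ≤ χ p) →
    ∀ Ξ : V3 × V3 × V3 → ℝ, Continuous Ξ → (∀ q, 0 ≤ Ξ q) → (∃ C : ℝ, ∀ q, Ξ q ≤ C) →
    ∀ η δ : ℝ, 0 < η → 0 < δ → ∀ m : ℝ, 1 ≤ m → ∃ N₀ : ℕ, ∀ N : ℕ, N₀ ≤ N →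
      localGibbsLaw σ a₀ u₀ θ₀ N (Φ N)
        {z | Kcrux σ N (Φ N) τ χ Ξ z - Rf σ N (Φ N) τ χ Ξ m z <
              c₂ * σ ^ 3 * (Ik σ N (Φ N) τ χ Ξ z - Ikcut σ N (Φ N) τ χ Ξ z) - η} ≤ ENNReal.ofReal δ := by
  sorry

/-- **S · SUBGRID DOMINATION — the r-step, shared restatement debt** (`stub_subgridDomination`; c4's `SubgridDomination` of
`Lines/SketchSplit.lean` pinned at the line's kinetic radius `ϱ_N = σ^{-1/2}(N+1)^{-1/3}`, with the crux's order `∃ r₀ ∀ r ∃ N₀`).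
A universal `C_d` such that along the flow the crux's `r`-mollified ideal functional is at most `C_d ×` the kinetic-cell one plus `η` in
probability: no volume-filling sub-`r` VELOCITY SEGREGATION of the one-particle law at scales between `ϱ_N` and `r`, for every `τ`
including post-shock (density-wise the finer mollification only helps, by Jensen; velocity-wise two streams `±U` filling a cell give
`B_r/B_ϱ ≈ U/(c√θ)`).  Every card for this crux owes this step (triage r1-1 "Common finding", r1-2 (R), r1-3): it is a regularity
statement about the hydrodynamic limit itself — false for entropy-class data (r-scale laminar shear, c4's `ShearDeficitPersistence`,
static half landed p126421), plausible from smooth profiles (kinetic-scale structures have vanishing viscous lifetime; between `ℓ` and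
`r` it is turbulence-cascade control), inaccessible to entropy / energy / stationarity.  Why it might fail: sustained volume-filling
sub-`r` drift contrast `≳ 4.5 Y √θ/g₀` along the flow of some smooth profile (none known; supersonic sub-`r` structure thermalises in
a crossing time).  Honours `Negative/RAfterN` (`r` before `N`; `ϱ_N ≫ 2ε_N`).  Difficulty: open-problem; deleted by the conforming
restatement (a) of RESTATE.md (kinetic-scale mollification). [size open] -/
def Stubs.stub_subgridDomination : Prop :=
  ∃ Cd : ℝ, 0 < Cd ∧
  ∀ (a₀ θ₀ : T3 → ℝ) (u₀ : T3 → V3), Continuous a₀ → Continuous θ₀ → Continuous u₀ → (∀ x, 0 < a₀ x) →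
    (∀ x, 0 < θ₀ x) → ∃ σ₀ : ℝ, 0 < σ₀ ∧ ∀ σ : ℝ, 0 < σ → σ < σ₀ →
    ∀ Φ : (N : ℕ) → HardSphereFlow (Torus.geometry (Fin 3)) (hsDiameter σ N) (N + 1),
    ∀ τ : ℝ, 0 < τ → ∀ χ : ℝ × T3 → ℝ, Continuous χ → (∀ p, 0 ≤ χ p) →
    ∀ Ξ : V3 × V3 × V3 → ℝ, Continuous Ξ → (∀ q, 0 ≤ Ξ q) → (∃ C : ℝ, ∀ q, Ξ q ≤ C) →
    ∀ η δ : ℝ, 0 < η → 0 < δ → ∃ r₀ : ℝ, 0 < r₀ ∧ ∀ r : ℝ, 0 < r → r < r₀ → ∃ N₀ : ℕ, ∀ N : ℕ, N₀ ≤ N →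
      localGibbsLaw σ a₀ u₀ θ₀ N (Φ N)
        {z | Cd * Ik σ N (Φ N) τ χ Ξ z + η < Irr σ N (Φ N) τ χ Ξ r z} ≤ ENNReal.ofReal δ

/-- Registered stub S (`Stubs.stub_subgridDomination`, verbatim). -/
theorem stub_subgridDomination :
  ∃ Cd : ℝ, 0 < Cd ∧
  ∀ (a₀ θ₀ : T3 → ℝ) (u₀ : T3 → V3), Continuous a₀ → Continuous θ₀ → Continuous u₀ → (∀ x, 0 < a₀ x) →
    (∀ x, 0 < θ₀ x) → ∃ σ₀ : ℝ, 0 < σ₀ ∧ ∀ σ : ℝ, 0 < σ → σ < σ₀ →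
    ∀ Φ : (N : ℕ) → HardSphereFlow (Torus.geometry (Fin 3)) (hsDiameter σ N) (N + 1),
    ∀ τ : ℝ, 0 < τ → ∀ χ : ℝ × T3 → ℝ, Continuous χ → (∀ p, 0 ≤ χ p) →
    ∀ Ξ : V3 × V3 × V3 → ℝ, Continuous Ξ → (∀ q, 0 ≤ Ξ q) → (∃ C : ℝ, ∀ q, Ξ q ≤ C) →
    ∀ η δ : ℝ, 0 < η → 0 < δ → ∃ r₀ : ℝ, 0 < r₀ ∧ ∀ r : ℝ, 0 < r → r < r₀ → ∃ N₀ : ℕ, ∀ N : ℕ, N₀ ≤ N →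
      localGibbsLaw σ a₀ u₀ θ₀ N (Φ N)
        {z | Cd * Ik σ N (Φ N) τ χ Ξ z + η < Irr σ N (Φ N) τ χ Ξ r z} ≤ ENNReal.ofReal δ := by
  sorry

/-! ## §4 The composition `RateFloor_of` (sorry-free): ring arithmetic + a six-fold union bound -/

/-- The real arithmetic of the chain: with `c_A c₁ = c₂ = g₁`, `κ = g₁/2`, `g₀ = g₁/(2 C_d)`, the six one-sided inequalities give
`K ≥ g₀ s I_r − (η₁ + η₂ + η₄ + η₅ + c_A s η₃ + g₀ s η₆)` by pure ring manipulation (no sign of any functional is needed). [folklore] -/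
theorem chain_arith {K R W KO If Ic I Ir cA c₁ c₂ κ Cd s g₁ η₁ η₂ η₃ η₄ η₅ η₆ : ℝ}
    (hcA : 0 ≤ cA) (hs : 0 ≤ s) (hCd : 0 < Cd) (hg₁ : 0 ≤ g₁)
    (hc₁ : cA * c₁ = g₁) (hc₂ : c₂ = g₁) (hκ : κ = g₁ / 2)
    (hT : W - KO - η₁ ≤ R) (hA : cA * s * If - η₂ ≤ W) (hF : c₁ * Ic - η₃ ≤ If)
    (hKO : KO ≤ κ * s * I + η₄) (hC : c₂ * s * (I - Ic) - η₅ ≤ K - R) (hS : Ir ≤ Cd * I + η₆) :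
    g₁ / (2 * Cd) * s * Ir - (η₁ + η₂ + η₄ + η₅ + cA * s * η₃ + g₁ / (2 * Cd) * s * η₆) ≤ K := by
  have hcs : 0 ≤ cA * s := mul_nonneg hcA hs
  have h1 : cA * s * (c₁ * Ic - η₃) ≤ cA * s * If := mul_le_mul_of_nonneg_left hF hcs
  have e1 : cA * s * (c₁ * Ic - η₃) = g₁ * s * Ic - cA * s * η₃ := by rw [← hc₁]; ring
  have hg₀ : 0 ≤ g₁ / (2 * Cd) * s := by positivity
  have h2 : g₁ / (2 * Cd) * s * Ir ≤ g₁ / (2 * Cd) * s * (Cd * I + η₆) := mul_le_mul_of_nonneg_left hS hg₀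
  have e2 : g₁ / (2 * Cd) * s * (Cd * I + η₆) = g₁ / 2 * s * I + g₁ / (2 * Cd) * s * η₆ := by
    field_simp
  have e3 : c₂ * s * (I - Ic) = g₁ * s * I - g₁ * s * Ic := by rw [hc₂]; ring
  have e4 : κ * s * I = g₁ / 2 * s * I := by rw [hκ]
  linarith [h1, h2, e1, e2, e3, e4, hT, hA, hKO, hC]

/-- The union bound of the chain: the crux's deviation event is contained in the union of the six stub events. [folklore] -/
theorem measure_chain_le {α : Type*} [MeasurableSpace α] (μ : Measure α) (K R W KO If Ic I Ir : α → ℝ)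
    {cA c₁ c₂ κ Cd s g₁ η η₁ η₂ η₃ η₄ η₅ η₆ : ℝ}
    (hcA : 0 ≤ cA) (hs : 0 ≤ s) (hCd : 0 < Cd) (hg₁ : 0 ≤ g₁)
    (hc₁ : cA * c₁ = g₁) (hc₂ : c₂ = g₁) (hκ : κ = g₁ / 2)
    (hη : η₁ + η₂ + η₄ + η₅ + cA * s * η₃ + g₁ / (2 * Cd) * s * η₆ ≤ η)
    {d₁ d₂ d₃ d₄ d₅ d₆ : ℝ≥0∞}
    (h1 : μ {z | R z < W z - KO z - η₁} ≤ d₁)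
    (h2 : μ {z | W z < cA * s * If z - η₂} ≤ d₂)
    (h3 : μ {z | If z < c₁ * Ic z - η₃} ≤ d₃)
    (h4 : μ {z | κ * s * I z + η₄ < KO z} ≤ d₄)
    (h5 : μ {z | K z - R z < c₂ * s * (I z - Ic z) - η₅} ≤ d₅)
    (h6 : μ {z | Cd * I z + η₆ < Ir z} ≤ d₆) :
    μ {z | K z < g₁ / (2 * Cd) * s * Ir z - η} ≤ d₁ + d₂ + d₃ + d₄ + d₅ + d₆ := by
  have hsub : {z | K z < g₁ / (2 * Cd) * s * Ir z - η} ⊆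
      (((({z | R z < W z - KO z - η₁} ∪ {z | W z < cA * s * If z - η₂}) ∪ {z | If z < c₁ * Ic z - η₃}) ∪
        {z | κ * s * I z + η₄ < KO z}) ∪ {z | K z - R z < c₂ * s * (I z - Ic z) - η₅}) ∪
        {z | Cd * I z + η₆ < Ir z} := by
    intro z hz
    by_contra hcon
    simp only [Set.mem_union, Set.mem_setOf_eq, not_or, not_lt] at hcon
    obtain ⟨⟨⟨⟨⟨hT, hA⟩, hF⟩, hKO⟩, hC⟩, hS⟩ := hcon
    have key := chain_arith hcA hs hCd hg₁ hc₁ hc₂ hκ hT hA hF hKO hC hS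
    have hz' : K z < g₁ / (2 * Cd) * s * Ir z - η := hz
    linarith
  calc μ {z | K z < g₁ / (2 * Cd) * s * Ir z - η}
      ≤ μ ((((({z | R z < W z - KO z - η₁} ∪ {z | W z < cA * s * If z - η₂}) ∪ {z | If z < c₁ * Ic z - η₃}) ∪
          {z | κ * s * I z + η₄ < KO z}) ∪ {z | K z - R z < c₂ * s * (I z - Ic z) - η₅}) ∪
          {z | Cd * I z + η₆ < Ir z}) := measure_mono hsub
    _ ≤ μ (((({z | R z < W z - KO z - η₁} ∪ {z | W z < cA * s * If z - η₂}) ∪ {z | If z < c₁ * Ic z - η₃}) ∪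
          {z | κ * s * I z + η₄ < KO z}) ∪ {z | K z - R z < c₂ * s * (I z - Ic z) - η₅}) +
        μ {z | Cd * I z + η₆ < Ir z} := measure_union_le _ _
    _ ≤ μ ((({z | R z < W z - KO z - η₁} ∪ {z | W z < cA * s * If z - η₂}) ∪ {z | If z < c₁ * Ic z - η₃}) ∪
          {z | κ * s * I z + η₄ < KO z}) + μ {z | K z - R z < c₂ * s * (I z - Ic z) - η₅} +
        μ {z | Cd * I z + η₆ < Ir z} := by gcongr; exact measure_union_le _ _
    _ ≤ μ (({z | R z < W z - KO z - η₁} ∪ {z | W z < cA * s * If z - η₂}) ∪ {z | If z < c₁ * Ic z - η₃}) +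
          μ {z | κ * s * I z + η₄ < KO z} + μ {z | K z - R z < c₂ * s * (I z - Ic z) - η₅} +
        μ {z | Cd * I z + η₆ < Ir z} := by gcongr; exact measure_union_le _ _
    _ ≤ μ ({z | R z < W z - KO z - η₁} ∪ {z | W z < cA * s * If z - η₂}) + μ {z | If z < c₁ * Ic z - η₃} +
          μ {z | κ * s * I z + η₄ < KO z} + μ {z | K z - R z < c₂ * s * (I z - Ic z) - η₅} +
        μ {z | Cd * I z + η₆ < Ir z} := by gcongr; exact measure_union_le _ _
    _ ≤ μ {z | R z < W z - KO z - η₁} + μ {z | W z < cA * s * If z - η₂} + μ {z | If z < c₁ * Ic z - η₃} +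
          μ {z | κ * s * I z + η₄ < KO z} + μ {z | K z - R z < c₂ * s * (I z - Ic z) - η₅} +
        μ {z | Cd * I z + η₆ < Ir z} := by gcongr; exact measure_union_le _ _
    _ ≤ d₁ + d₂ + d₃ + d₄ + d₅ + d₆ := by gcongr

/-- Six sixths. [folklore] -/
theorem ofReal_sixth_sum {δ : ℝ} (hδ : 0 ≤ δ) :
    ENNReal.ofReal (δ / 6) + ENNReal.ofReal (δ / 6) + ENNReal.ofReal (δ / 6) + ENNReal.ofReal (δ / 6) +
      ENNReal.ofReal (δ / 6) + ENNReal.ofReal (δ / 6) = ENNReal.ofReal δ := by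
  have h : 0 ≤ δ / 6 := by positivity
  rw [← ENNReal.ofReal_add h h, ← ENNReal.ofReal_add (by positivity) h, ← ENNReal.ofReal_add (by positivity) h,
    ← ENNReal.ofReal_add (by positivity) h, ← ENNReal.ofReal_add (by positivity) h]
  congr 1
  ring

/-- **THE COMPOSITION** `T → A → F → KO → C → S → RateFloor` (kernel-checked, sorry-free; concludes the route decl BY NAME).
Bookkeeping: `g₁ := min (c_A c_F) c_c`, run F with `c₁ := g₁/c_A`, C with `c₂ := g₁`, KO with `κ := g₁/2`; the crux's `g₀ := g₁/(2C_d)`;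
`σ₀ := min` of the six; slacks `η/8` (T, A, KO, C), `η/(8(c_Aσ³+1))` (F), `η/(8(g₀σ³+1))` (S); confidences `δ/6`; `r₀` from S; the
fresh window `m := m₀` from F; `N₀ := max` of the six; then `measure_chain_le` after `show`ing the crux's zeta-reduced text as
`Kcrux … < g₀ σ³ Irr … − η` (definitional). [folklore] -/
theorem RateFloor_of (hT : Stubs.stub_tubeTransport) (hA : Stubs.stub_freshTubesUniform)
    (hF : Stubs.stub_freshFraction) (hKO : Stubs.stub_knockOutSmall) (hC : Stubs.stub_complementFloor)
    (hS : Stubs.stub_subgridDomination) :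
    Summit.AtomisticToContinuum.HydrodynamicLimit.Theses.JParityClosure.RateFloor := by
  obtain ⟨cA, hcA, hA⟩ := hA
  obtain ⟨cF, hcF, hF⟩ := hF
  obtain ⟨cc, hcc, hC⟩ := hC
  obtain ⟨Cd, hCd, hS⟩ := hS
  set g₁ : ℝ := min (cA * cF) cc with hg₁def
  have hg₁pos : 0 < g₁ := lt_min (mul_pos hcA hcF) hcc
  have hg₁A : g₁ ≤ cA * cF := min_le_left _ _
  have hg₁c : g₁ ≤ cc := min_le_right _ _
  have hc₁pos : 0 < g₁ / cA := div_pos hg₁pos hcA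
  have hc₁le : g₁ / cA ≤ cF := by
    rw [div_le_iff₀ hcA]
    linarith [mul_comm cA cF]
  have hF := hF (g₁ / cA) hc₁pos hc₁le
  have hC := hC g₁ hg₁pos hg₁c
  have hKO := hKO (g₁ / 2) (by positivity)
  refine ⟨g₁ / (2 * Cd), by positivity, fun a₀ θ₀ u₀ ha hθ hu ha0 hθ0 => ?_⟩
  obtain ⟨σ₁, hσ₁, hT⟩ := hT a₀ θ₀ u₀ ha hθ hu ha0 hθ0
  obtain ⟨σ₂, hσ₂, hA⟩ := hA a₀ θ₀ u₀ ha hθ hu ha0 hθ0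
  obtain ⟨σ₃, hσ₃, hF⟩ := hF a₀ θ₀ u₀ ha hθ hu ha0 hθ0
  obtain ⟨σ₄, hσ₄, hKO⟩ := hKO a₀ θ₀ u₀ ha hθ hu ha0 hθ0
  obtain ⟨σ₅, hσ₅, hC⟩ := hC a₀ θ₀ u₀ ha hθ hu ha0 hθ0
  obtain ⟨σ₆, hσ₆, hS⟩ := hS a₀ θ₀ u₀ ha hθ hu ha0 hθ0
  refine ⟨min (min (min σ₁ σ₂) (min σ₃ σ₄)) (min σ₅ σ₆),
    lt_min (lt_min (lt_min hσ₁ hσ₂) (lt_min hσ₃ hσ₄)) (lt_min hσ₅ hσ₆), ?_⟩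
  intro σ hσ hσlt Φ τ hτ χ hχc hχ0 Ξ hΞc hΞ0 hΞC η δ hη hδ
  have hσ12 : σ < min σ₁ σ₂ := (hσlt.trans_le (min_le_left _ _)).trans_le (min_le_left _ _)
  have hσ34 : σ < min σ₃ σ₄ := (hσlt.trans_le (min_le_left _ _)).trans_le (min_le_right _ _)
  have hσ56 : σ < min σ₅ σ₆ := hσlt.trans_le (min_le_right _ _)
  have hσ1 : σ < σ₁ := hσ12.trans_le (min_le_left _ _)
  have hσ2 : σ < σ₂ := hσ12.trans_le (min_le_right _ _)
  have hσ3 : σ < σ₃ := hσ34.trans_le (min_le_left _ _)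
  have hσ4 : σ < σ₄ := hσ34.trans_le (min_le_right _ _)
  have hσ5 : σ < σ₅ := hσ56.trans_le (min_le_left _ _)
  have hσ6 : σ < σ₆ := hσ56.trans_le (min_le_right _ _)
  have hs3 : (0 : ℝ) ≤ σ ^ 3 := by positivity
  -- slacks
  set η₈ : ℝ := η / 8 with hη₈
  set η₃' : ℝ := η / (8 * (cA * σ ^ 3 + 1)) with hη₃'
  set η₆' : ℝ := η / (8 * (g₁ / (2 * Cd) * σ ^ 3 + 1)) with hη₆'
  have hη₈pos : 0 < η₈ := by positivity
  have hη₃pos : 0 < η₃' := by positivity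
  have hη₆pos : 0 < η₆' := by positivity
  have hA3 : cA * σ ^ 3 * η₃' ≤ η / 8 := by
    have hc : 0 ≤ cA * σ ^ 3 := by positivity
    rw [hη₃', show cA * σ ^ 3 * (η / (8 * (cA * σ ^ 3 + 1))) = η / 8 * (cA * σ ^ 3 / (cA * σ ^ 3 + 1)) by
      field_simp]
    exact mul_le_of_le_one_right (by positivity) ((div_le_one (by positivity)).2 (by linarith))
  have hS6 : g₁ / (2 * Cd) * σ ^ 3 * η₆' ≤ η / 8 := by
    have hc : 0 ≤ g₁ / (2 * Cd) * σ ^ 3 := by positivity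
    rw [hη₆', show g₁ / (2 * Cd) * σ ^ 3 * (η / (8 * (g₁ / (2 * Cd) * σ ^ 3 + 1))) =
        η / 8 * (g₁ / (2 * Cd) * σ ^ 3 / (g₁ / (2 * Cd) * σ ^ 3 + 1)) by field_simp]
    exact mul_le_of_le_one_right (by positivity) ((div_le_one (by positivity)).2 (by linarith))
  have hsum : η₈ + η₈ + η₈ + η₈ + cA * σ ^ 3 * η₃' + g₁ / (2 * Cd) * σ ^ 3 * η₆' ≤ η := by
    rw [hη₈]; linarith
  have hδ6 : 0 < δ / 6 := by positivity
  -- instantiate the six stubs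
  have eT := hT σ hσ hσ1 Φ τ hτ χ hχc hχ0 Ξ hΞc hΞ0 hΞC η₈ (δ / 6) hη₈pos hδ6
  have eA := hA σ hσ hσ2 Φ τ hτ χ hχc hχ0 Ξ hΞc hΞ0 hΞC η₈ (δ / 6) hη₈pos hδ6
  have eF := hF σ hσ hσ3 Φ τ hτ χ hχc hχ0 Ξ hΞc hΞ0 hΞC η₃' (δ / 6) hη₃pos hδ6
  have eKO := hKO σ hσ hσ4 Φ τ hτ χ hχc hχ0 Ξ hΞc hΞ0 hΞC η₈ (δ / 6) hη₈pos hδ6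
  have eC := hC σ hσ hσ5 Φ τ hτ χ hχc hχ0 Ξ hΞc hΞ0 hΞC η₈ (δ / 6) hη₈pos hδ6
  have eS := hS σ hσ hσ6 Φ τ hτ χ hχc hχ0 Ξ hΞc hΞ0 hΞC η₆' (δ / 6) hη₆pos hδ6
  obtain ⟨r₀, hr₀, eS⟩ := eS
  refine ⟨r₀, hr₀, fun r hr hrlt => ?_⟩
  obtain ⟨N₆, eS⟩ := eS r hr hrlt
  obtain ⟨m₀, hm₀, eF⟩ := eF
  obtain ⟨N₃, eF⟩ := eF m₀ le_rfl
  obtain ⟨N₁, eT⟩ := eT m₀ hm₀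
  obtain ⟨N₂, eA⟩ := eA m₀ hm₀
  obtain ⟨N₄, eKO⟩ := eKO m₀ hm₀
  obtain ⟨N₅, eC⟩ := eC m₀ hm₀
  refine ⟨max (max (max N₁ N₂) (max N₃ N₄)) (max N₅ N₆), fun N hN => ?_⟩
  have hN12 : max N₁ N₂ ≤ N := ((le_max_left _ _).trans (le_max_left _ _)).trans hN
  have hN34 : max N₃ N₄ ≤ N := ((le_max_right _ _).trans (le_max_left _ _)).trans hN
  have hN56 : max N₅ N₆ ≤ N := (le_max_right _ _).trans hN
  have e1 := eT N ((le_max_left _ _).trans hN12)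
  have e2 := eA N ((le_max_right _ _).trans hN12)
  have e3 := eF N ((le_max_left _ _).trans hN34)
  have e4 := eKO N ((le_max_right _ _).trans hN34)
  have e5 := eC N ((le_max_left _ _).trans hN56)
  have e6 := eS N ((le_max_right _ _).trans hN56)
  show localGibbsLaw σ a₀ u₀ θ₀ N (Φ N)
      {z | Kcrux σ N (Φ N) τ χ Ξ z < g₁ / (2 * Cd) * σ ^ 3 * Irr σ N (Φ N) τ χ Ξ r z - η} ≤ ENNReal.ofReal δ
  have h := measure_chain_le (localGibbsLaw σ a₀ u₀ θ₀ N (Φ N)) (Kcrux σ N (Φ N) τ χ Ξ)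
    (Rf σ N (Φ N) τ χ Ξ m₀) (Wf σ N (Φ N) τ χ Ξ m₀) (KOf σ N (Φ N) τ χ Ξ m₀) (Ikfresh σ N (Φ N) τ χ Ξ m₀)
    (Ikcut σ N (Φ N) τ χ Ξ) (Ik σ N (Φ N) τ χ Ξ) (Irr σ N (Φ N) τ χ Ξ r)
    hcA.le hs3 hCd hg₁pos.le (by field_simp : cA * (g₁ / cA) = g₁) rfl rfl hsum e1 e2 e3 e4 e5 e6
  refine h.trans (le_of_eq ?_)
  exact ofReal_sixth_sum hδ.le

end Summit.AtomisticToContinuum.HydrodynamicLimit.Cruxes.RateFloor.LastFlightPoissonization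

end
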